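import Literature.NumberTheory.EllipticCurves.PoonenRainsCocycle
import Literature.NumberTheory.EllipticCurves.WeilPairingTateDual
import Summits.BirchSwinnertonDyer.Rank1Residual.X11b.BDPRouteRelaxation
import HarnessLib

/-!
# Route `GenusKolyvaginAtTwo`, crux #2 `GenusPrimitiveSupplyAtTwo` (stmt-BirchSwinnertonDyer-22136):
# KRAMER PARITY VIA QUADRATIC SELMER STRUCTURES, part 6 — the POLAR FORM of the Poonen–Rains map is the Weil cup
# product: hypothesis (Q1) of `kramerParity_of_tateQuadraticForms_canonical` for `q_v = inv_v ∘ prClass`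

Width seat `bsd-line-gk2-p4` g11 (cell `bsd-f1-sign2`); item (F3b) of the lead's (gk2-p1 g10) memo `Lines/genus-supply-pr-quadratic-form.md`
§2. THEOREMS ONLY (no definition, no named fact, no `sorry`); helper `--supports stmt-BirchSwinnertonDyer-22136`; no item is closed; BSD
is not proved by any of this.

* `zmod2_prod_cases` — in `ℤ/2 × ℤ/2`, two distinct non-zero vectors and their sum exhaust the non-zero vectors (`decide`);
* `weilPairing_two_eq_neg_one` — **at level `2` a Weil pairing is `−1` on distinct non-zero points** (any `e : E[2] × E[2] → K̄` with
  `e² = 1`, biadditive, alternating, non-degenerate — the six properties of `WeierstrassCurve.exists_weilPairing`); hence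
  **`weilPairingHom_two_eq_commForm`: `e` IS the commutator form of the level-`2` theta datum `heisenbergMu W h2`**
  (`coe_toMul_commForm_heisenbergGm`: both are `−1` exactly on distinct non-zero points);
* **`prClass_add`** — for local classes `x, y ∈ H¹(K_v, E[2])`:
  `prClass(x + y) − prClass x − prClass y = y ∪ₑ x` in `H²(K_v, μ₂)` (`HeisenbergDatum.conn_add` = Zarhin / Poonen–Rains Cor. 4.6;
  the coboundary `∂b`, `b(σ) = m(ξ_σ, η_σ)`, dies in cohomology; the cup cocycle is `ContPairing.cupCocycle` of the tree's
  `weilContPairingLocal`), and `prClass_add'` with `x ∪ₑ y` (symmetry of the polar form);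
* **`tateQuadraticForm_prClass_Q1`** — (Q1) of part 4's `kramerParity_of_tateQuadraticForms_canonical`, for EVERY family `inv` of local
  invariant maps (in particular `LocalInvariants.canonical K 2`) and EVERY Weil pairing `e`:
  `q_v(x+y) = q_v x + q_v y + invWeilPairing W 2 e hμ hadd₁ hadd₂ hgal inv v x y` for `q_v x := inv_v (prClass W h2 K_v x)` (level
  `((2 : ℕ) : ℤ)`, two-step ascription as in the API card `Lines/genus-supply-kramer-bridge.md` §1b).

References: [PoonenRains2012] Prop. 4.5 (c), Cor. 4.6 (arXiv:1009.0287 §4.1); [KlagsbrunMazurRubin2013] Def. 3.2; [SilvermanAEC2009]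
III.8.1; [SerreGaloisCohomology1997] I §2.3, §5.7.
-/

set_option linter.dupNamespace false -- tree convention: `Summit.BirchSwinnertonDyer.BirchSwinnertonDyer.Theorems` (summit = sub-problem)
set_option autoImplicit false

namespace Summit.BirchSwinnertonDyer.BirchSwinnertonDyer.Theorems.GenusKolyKramer

/-! ## §0 Combinatorics of `ℤ/2 × ℤ/2` -/

/-- In `ℤ/2 × ℤ/2`, if `a, b` are distinct and non-zero then every vector is `0`, `a`, `b` or `a + b`. [folklore] -/
theorem zmod2_prod_cases (a b s : ZMod 2 × ZMod 2) :
    a ≠ 0 → b ≠ 0 → a ≠ b → (s = 0 ∨ s = a ∨ s = b ∨ s = a + b) := by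
  obtain ⟨a₁, a₂⟩ := a
  obtain ⟨b₁, b₂⟩ := b
  obtain ⟨s₁, s₂⟩ := s
  fin_cases a₁ <;> fin_cases a₂ <;> fin_cases b₁ <;> fin_cases b₂ <;> fin_cases s₁ <;> fin_cases s₂ <;> decide

end Summit.BirchSwinnertonDyer.BirchSwinnertonDyer.Theorems.GenusKolyKramer

noncomputable section

open scoped Classical ContRepresentation

namespace Summit.BirchSwinnertonDyer.BirchSwinnertonDyer.Theorems.GenusKolyKramer

open WeierstrassCurve Field NumberField IsDedekindDomain Function
open Literature.Algebra.Homology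
open Literature.NumberTheory.EllipticCurves Literature.NumberTheory.EllipticCurves.ThetaLevelTwo
open Literature.NumberTheory.EllipticCurves.DokchitserDokchitser2012 (frame)
open Literature.NumberTheory.GaloisRepresentations
open Literature.NumberTheory.GaloisRepresentations.DiscreteGaloisModule (mu MuCarrier)
open Literature.NumberTheory.GaloisCohomology
open Summit.BirchSwinnertonDyer.Rank1Residual.X11b.Relaxation

variable {K : Type} [Field K] [NumberField K] (W : WeierstrassCurve K) [W.IsElliptic] (h2 : (2 : K) ≠ 0)
variable (e : geomTorsion W ((2 : ℕ) : ℤ) → geomTorsion W ((2 : ℕ) : ℤ) → AlgebraicClosure K)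
  (hμ : ∀ S T, e S T ^ 2 = 1)
  (hadd₁ : ∀ S₁ S₂ T, e (S₁ + S₂) T = e S₁ T * e S₂ T)
  (hadd₂ : ∀ S T₁ T₂, e S (T₁ + T₂) = e S T₁ * e S T₂)
  (hgal : ∀ (σ : absoluteGaloisGroup K) (S T : geomTorsion W ((2 : ℕ) : ℤ)), σ • e S T = e (σ • S) (σ • T))
  (halt : ∀ T, e T T = 1) (hnondeg : ∀ T, (∀ S, e S T = 1) → T = 0)

/-! ## §1 At level `2` a Weil pairing IS the commutator form of the theta datum -/

omit [NumberField K] [W.IsElliptic] in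
include hμ hadd₁ in
/-- `e(O, T) = 1`. [cite: SilvermanAEC2009, Prop. III.8.1 (a) (bilinearity)] -/
theorem weilPairing_zero_left (T : geomTorsion W ((2 : ℕ) : ℤ)) : e 0 T = 1 := by
  have h := hadd₁ 0 0 T
  rw [add_zero] at h
  have hne : e 0 T ≠ 0 := fun h0 => by
    have := hμ 0 T
    rw [h0, zero_pow two_ne_zero] at this
    exact zero_ne_one this
  -- `e 0 T = e 0 T * e 0 T`
  have := mul_left_cancel₀ hne (h.symm.trans (mul_one _).symm)
  exact this

omit [NumberField K] [W.IsElliptic] in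
include hμ hadd₂ in
/-- `e(S, O) = 1`. [cite: SilvermanAEC2009, Prop. III.8.1 (a) (bilinearity)] -/
theorem weilPairing_zero_right (S : geomTorsion W ((2 : ℕ) : ℤ)) : e S 0 = 1 := by
  have h := hadd₂ S 0 0
  rw [add_zero] at h
  have hne : e S 0 ≠ 0 := fun h0 => by
    have := hμ S 0
    rw [h0, zero_pow two_ne_zero] at this
    exact zero_ne_one this
  exact mul_left_cancel₀ hne (h.symm.trans (mul_one _).symm)

omit [NumberField K] in
include h2 hμ hadd₁ halt hnondeg in
/-- **At level `2` a Weil pairing takes the value `−1` on distinct non-zero points**: `e(·, Q)` is `±1`-valued, kills `O` and `Q`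
(alternating), and `E[2] = {O, P, Q, P + Q}`, so `e(P, Q) = 1` would make `e(·, Q)` trivial, contradicting non-degeneracy.
[cite: SilvermanAEC2009, Prop. III.8.1] -/
theorem weilPairing_two_eq_neg_one {P Q : geomTorsion W ((2 : ℕ) : ℤ)} (hP : P ≠ 0) (hQ : Q ≠ 0) (hPQ : P ≠ Q) :
    e P Q = -1 := by
  have hpm : ∀ S T, e S T = 1 ∨ e S T = -1 := fun S T =>
    mul_self_eq_one_iff.mp (by rw [← sq]; exact hμ S T)
  rcases hpm P Q with h1 | h1
  · exfalso
    -- `E[2] = {0, P, Q, P + Q}` through a frame `E[2] ≅ ℤ/2 × ℤ/2`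
    have henum : ∀ S : geomTorsion W ((2 : ℕ) : ℤ), S = 0 ∨ S = P ∨ S = Q ∨ S = P + Q := by
      intro S
      have hP' : frame W h2 P ≠ 0 := fun h => hP ((frame W h2).injective (by rw [h, map_zero]))
      have hQ' : frame W h2 Q ≠ 0 := fun h => hQ ((frame W h2).injective (by rw [h, map_zero]))
      have hPQ' : frame W h2 P ≠ frame W h2 Q := fun h => hPQ ((frame W h2).injective h)
      rcases zmod2_prod_cases _ _ (frame W h2 S) hP' hQ' hPQ' with h | h | h | h
      · exact Or.inl ((frame W h2).injective (by rw [h, map_zero]))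
      · exact Or.inr (Or.inl ((frame W h2).injective h))
      · exact Or.inr (Or.inr (Or.inl ((frame W h2).injective h)))
      · exact Or.inr (Or.inr (Or.inr ((frame W h2).injective (by rw [h, map_add]))))
    refine hQ (hnondeg Q fun S => ?_)
    rcases henum S with h | h | h | h <;> rw [h]
    · exact weilPairing_zero_left W e hμ hadd₁ Q
    · exact h1
    · exact halt Q
    · rw [hadd₁, h1, halt, one_mul]
  · exact h1

omit [NumberField K] in
include h2 hμ hadd₁ hadd₂ halt hnondeg in
/-- **A level-`2` Weil pairing IS the commutator form of the theta datum `heisenbergMu W h2`** (as `μ₂`-valued biadditive maps):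
both equal `−1` exactly on pairs of distinct non-zero points (`coe_toMul_commForm_heisenbergGm`, Poonen–Rains Prop. 4.5 (c)) and
`1` otherwise. [cite: PoonenRains2012, Prop. 4.5 (c) (commutator pairing = Weil pairing)] [cite: SilvermanAEC2009, Prop. III.8.1] -/
theorem weilPairingHom_two_eq_commForm (P Q : geomTorsion W ((2 : ℕ) : ℤ)) :
    weilPairingHom W 2 e hμ hadd₁ hadd₂ P Q = (heisenbergMu W h2).commForm P Q := by
  rw [muCarrier_eq_iff, coe_weilPairingHom]
  -- the commutator form of `heisenbergMu`, computed in `K̄`, is that of `heisenbergGm`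
  have hcoe : (((MuCarrier.toAdditive ((heisenbergMu W h2).commForm P Q)).toMul :
      (AlgebraicClosure K)ˣ) : AlgebraicClosure K) =
      ((Additive.toMul ((heisenbergGm W h2).commForm P Q) : (AlgebraicClosure K)ˣ) : AlgebraicClosure K) := by
    rw [heisenbergMu, HeisenbergDatum.commForm_mapValues, coe_muTwoToCarrier, HeisenbergDatum.coe_commForm_codRestrict]
  rw [hcoe]
  by_cases hP : P = 0
  · subst hP
    rw [weilPairing_zero_left W e hμ hadd₁, HeisenbergDatum.commForm_zero_left, toMul_zero, Units.val_one]
  by_cases hQ : Q = 0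
  · subst hQ
    rw [weilPairing_zero_right W e hμ hadd₂, HeisenbergDatum.commForm_zero_right, toMul_zero, Units.val_one]
  by_cases hPQ : P = Q
  · subst hPQ
    rw [halt, HeisenbergDatum.commForm_self, toMul_zero, Units.val_one]
  rw [weilPairing_two_eq_neg_one W h2 e hμ hadd₁ halt hnondeg hP hQ hPQ, coe_toMul_commForm_heisenbergGm W h2 hP hQ hPQ]

/-! ## §2 The polar form of `prClass` is the Weil cup product -/

/-- `prClass` on a representing cocycle, read with level `((2 : ℕ) : ℤ)` and the `toLocal` spelling of X11b, as an element of
Mathlib's `continuousCohomology 2` (the lead's `prClass_oneCocycleClass`, transported along the definitional identifications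
`E[↑2] = E[2]`, `M.toLocal v = M|_{K_v}`). [cite: PoonenRains2012, Cor. 4.6 (the quadratic form q : H¹(A[λ]) → H²(G_m))] -/
theorem twoCocycleClass_prCocycle_eq_prClass (v : Place K)
    (ζ : contOneCocycles (DiscreteGaloisModule.toTopRep ((W.torsionGaloisModule ((2 : ℕ) : ℤ)).toLocal v))) :
    haveI : CompactSpace (absoluteGaloisGroup (Place.Completion v)) := absoluteGaloisGroup_compactSpace _
    twoCocycleClass (DiscreteGaloisModule.toTopRep ((mu K 2).toLocal v))
        (show contTwoCocycles (DiscreteGaloisModule.toTopRep ((mu K 2).toLocal v)) from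
          prCocycle W h2 (Place.Completion v)
            (show contOneCocycles (DiscreteGaloisModule.toTopRep ((W.torsionGaloisModule (2 : ℤ)).toLocal v)) from ζ)) =
      prClass W h2 (Place.Completion v)
        (show galoisCohomology ((W.torsionGaloisModule (2 : ℤ)).toLocal v) 1 from
          oneCocycleClass (DiscreteGaloisModule.toTopRep ((W.torsionGaloisModule ((2 : ℕ) : ℤ)).toLocal v)) ζ) := by
  haveI : CompactSpace (absoluteGaloisGroup (Place.Completion v)) := absoluteGaloisGroup_compactSpace _
  exact (prClass_oneCocycleClass W h2 (Place.Completion v) _).symm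

/-! ## §3 Hypothesis (Q1) of `kramerParity_of_tateQuadraticForms_canonical` -/

include halt hnondeg in
/-- **POLAR FORM OF THE POONEN–RAINS MAP = WEIL CUP PRODUCT — hypothesis (Q1)** (Zarhin; Poonen–Rains Cor. 4.6; KMR Def. 3.2
"Tate quadratic form"): for every family `inv` of local invariant maps (in particular `LocalInvariants.canonical K 2`), every
level-`2` Weil pairing `e` (§1: `e` is the commutator form of the theta datum) and local classes `x, y ∈ H¹(K_v, E[2])`,
`q_v(x + y) = q_v x + q_v y + inv_v(x ∪ₑ y)` for `q_v x := inv_v (prClass W h2 K_v x)` (written with the two-step level ascription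
of the API card `Lines/genus-supply-kramer-bridge.md` §1b), the pairing term being X11b's `invWeilPairing`. On representing cocycles
this is `HeisenbergDatum.conn_add`: `conn(ξ+η) − conn ξ − conn η − (η ∪ₑ ξ) = ∂b`, `b(σ) = −m(ξ_σ, η_σ)` continuous, and
`y ∪ x = x ∪ y` on classes because the left side is symmetric. [cite: PoonenRains2012, Cor. 4.6 (quadraticity, polar form = cup product)]
[cite: KlagsbrunMazurRubin2013, Def. 3.2] -/
theorem tateQuadraticForm_prClass_Q1 (inv : LocalInvariants K 2) (v : Place K)
    (x y : galoisCohomology ((W.torsionGaloisModule ((2 : ℕ) : ℤ)).toLocal v) 1) :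
    (fun (v : Place K) (x : galoisCohomology ((W.torsionGaloisModule ((2 : ℕ) : ℤ)).toLocal v) 1) =>
        inv v (prClass W h2 (Place.Completion v)
          (show galoisCohomology ((W.torsionGaloisModule (2 : ℤ)).toLocal v) 1 from x))) v (x + y) =
      (fun (v : Place K) (x : galoisCohomology ((W.torsionGaloisModule ((2 : ℕ) : ℤ)).toLocal v) 1) =>
          inv v (prClass W h2 (Place.Completion v)
            (show galoisCohomology ((W.torsionGaloisModule (2 : ℤ)).toLocal v) 1 from x))) v x +
      (fun (v : Place K) (x : galoisCohomology ((W.torsionGaloisModule ((2 : ℕ) : ℤ)).toLocal v) 1) =>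
          inv v (prClass W h2 (Place.Completion v)
            (show galoisCohomology ((W.torsionGaloisModule (2 : ℤ)).toLocal v) 1 from x))) v y +
      invWeilPairing W 2 e hμ hadd₁ hadd₂ hgal inv v x y := by
  haveI : CompactSpace (absoluteGaloisGroup (Place.Completion v)) := absoluteGaloisGroup_compactSpace _
  -- notation: everything is read in the `toLocal` / level-`↑2` world of X11b, classes in Mathlib's `continuousCohomology`
  let L := Place.Completion v
  let A := DiscreteGaloisModule.toTopRep ((W.torsionGaloisModule ((2 : ℕ) : ℤ)).toLocal v)
  let C := DiscreteGaloisModule.toTopRep ((mu K 2).toLocal v)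
  let PR : galoisCohomology ((W.torsionGaloisModule ((2 : ℕ) : ℤ)).toLocal v) 1 → continuousCohomology 2 C :=
    fun z => prClass W h2 L (show galoisCohomology ((W.torsionGaloisModule (2 : ℤ)).toLocal v) 1 from z)
  let PRC : contOneCocycles A → contTwoCocycles C := fun ζ =>
    show contTwoCocycles C from
      prCocycle W h2 L (show contOneCocycles (DiscreteGaloisModule.toTopRep ((W.torsionGaloisModule (2 : ℤ)).toLocal v)) from ζ)
  let invC : continuousCohomology 2 C →+ ZMod 2 := show continuousCohomology 2 C →+ ZMod 2 from inv v
  let cup := (weilContPairingLocal W 2 e hμ hadd₁ hadd₂ hgal v).cupProduct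
  let cls : contOneCocycles A → galoisCohomology ((W.torsionGaloisModule ((2 : ℕ) : ℤ)).toLocal v) 1 :=
    fun ζ => oneCocycleClass A ζ
  let D := localDatum W h2 L
  have hPR : ∀ ζ : contOneCocycles A, PR (cls ζ) = twoCocycleClass C (PRC ζ) :=
    fun ζ => (twoCocycleClass_prCocycle_eq_prClass W h2 v ζ).symm
  have hPRC : ∀ (ζ : contOneCocycles A) (σ τ : absoluteGaloisGroup L), (PRC ζ).1 (σ, τ) = D.conn (fun g => ζ.1 g) σ τ :=
    fun ζ σ τ => rfl
  obtain ⟨ξ, rfl⟩ := oneCocycleClass_surjective A x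
  obtain ⟨η, rfl⟩ := oneCocycleClass_surjective A y
  show invC (PR (cls ξ + cls η)) = invC (PR (cls ξ)) + invC (PR (cls η)) + invC (cup (cls ξ) (cls η))
  -- the class identity `PR[ζ₁+ζ₂] = PR[ζ₁] + PR[ζ₂] + [ζ₂ ∪ ζ₁]` for all representing cocycles
  have hgen : ∀ ζ₁ ζ₂ : contOneCocycles A,
      PR (cls ζ₁ + cls ζ₂) = PR (cls ζ₁) + PR (cls ζ₂) + cup (cls ζ₂) (cls ζ₁) := by
    intro ζ₁ ζ₂
    have hadd : cls ζ₁ + cls ζ₂ = cls (ζ₁ + ζ₂) := (oneCocycleClass_add A ζ₁ ζ₂).symm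
    have hcup : cup (cls ζ₂) (cls ζ₁) = twoCocycleClass C ((weilContPairingLocal W 2 e hμ hadd₁ hadd₂ hgal v).cupCocycle ζ₂ ζ₁) :=
      ContPairing.cupProduct_oneCocycleClass_eq_twoCocycleClass _ ζ₂ ζ₁
    rw [hadd, hPR, hPR, hPR, hcup, ← twoCocycleClass_add, ← twoCocycleClass_add, ← sub_eq_zero,
      ← twoCocycleClass_sub, twoCocycleClass_eq_zero_iff]
    -- the coboundary of `b(σ) = -m(ζ₁ σ, ζ₂ σ)`
    let b : absoluteGaloisGroup L → MuCarrier K 2 := fun σ => -D.m (ζ₁.1 σ) (ζ₂.1 σ)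
    have hb : Continuous b := by
      have hpair : Continuous fun σ : absoluteGaloisGroup L => (ζ₁.1 σ, ζ₂.1 σ) := ζ₁.1.continuous.prodMk ζ₂.1.continuous
      have : b = (fun t : geomTorsion W ((2 : ℕ) : ℤ) × geomTorsion W ((2 : ℕ) : ℤ) => -D.m t.1 t.2) ∘
          (fun σ : absoluteGaloisGroup L => (ζ₁.1 σ, ζ₂.1 σ)) := by funext σ; rfl
      rw [this]
      exact continuous_of_discreteTopology.comp hpair
    refine ⟨⟨b, hb⟩, fun σ τ => ?_⟩
    have hζ₁ : D.IsCrossedHom (fun g => ζ₁.1 g) := isCrossedHom_of_mem W h2 L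
      (show contOneCocycles (DiscreteGaloisModule.toTopRep ((W.torsionGaloisModule (2 : ℤ)).toLocal v)) from ζ₁)
    have hζ₂ : D.IsCrossedHom (fun g => ζ₂.1 g) := isCrossedHom_of_mem W h2 L
      (show contOneCocycles (DiscreteGaloisModule.toTopRep ((W.torsionGaloisModule (2 : ℤ)).toLocal v)) from ζ₂)
    have key := D.conn_add hζ₁ hζ₂ σ τ
    have hcupval : ((weilContPairingLocal W 2 e hμ hadd₁ hadd₂ hgal v).cupCocycle ζ₂ ζ₁).1 (σ, τ) =
        D.commForm (ζ₂.1 σ) (D.ρ σ (ζ₁.1 τ)) := by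
      rw [ContPairing.cupCocycle_apply_eq_smul, weilContPairingLocal_toLin_apply,
        weilPairingHom_two_eq_commForm W h2 e hμ hadd₁ hadd₂ halt hnondeg, localDatum_ρ_apply]
      rfl
    have hsum : (fun g => (ζ₁ + ζ₂).1 g) = (fun g => ζ₁.1 g) + (fun g => ζ₂.1 g) := by funext g; rfl
    rw [Submodule.coe_sub, Submodule.coe_add, Submodule.coe_add, ContinuousMap.sub_apply, ContinuousMap.add_apply,
      ContinuousMap.add_apply, hPRC, hPRC, hPRC, hcupval, hsum, key]
    show _ = D.α σ (b τ) - b (σ * τ) + b σ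
    simp only [b, map_neg]
    abel
  -- symmetry of the cup product term: compare the identity for `(ξ, η)` and for `(η, ξ)`
  have h1 := hgen ξ η
  have h2' := hgen η ξ
  rw [add_comm (cls η) (cls ξ), h1, add_comm (PR (cls η)) (PR (cls ξ))] at h2'
  have hswap := add_left_cancel h2'
  -- `hswap : [η ∪ ξ] = [ξ ∪ η]`
  rw [h1, map_add, map_add, hswap]

end Summit.BirchSwinnertonDyer.BirchSwinnertonDyer.Theorems.GenusKolyKramer

end
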